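import Summits.ResolutionOfSingularities.ResolutionOfSingularities.Theorems.FrobeniusClosingSteerGeoDictQuadratic
import Summits.ResolutionOfSingularities.ResolutionOfSingularities.Theorems.FrobeniusClosingSteerPBasisDual
import Literature.AlgebraicGeometry.Resolution.LocalBlowup
import Mathlib.RingTheory.EssentialFiniteness
import Mathlib.FieldTheory.IntermediateField.Adjoin.Algebra
import Mathlib.RingTheory.LocalRing.ResidueField.Basic
import HarnessLib

/-!
# Crux `Steer` (stmt-ResolutionOfSingularities-16345), chain W4.1, R2 σ_top line, piece G⁺ `GeoDictFin` — G11, the RESIDUE DATUM: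
# the residue field of a chain ring `R_P ⊆ K` is a finitely generated extension of the ground field (Theses-free)

OURS (campaign `res-hironaka`, rung L ★L-G4, slot W4.1, chain W4.1, seat `res-type-096`; replaces the role of no printed item; NOT a
statement of the manuscript under review; AI review is weaker than expert review). Object: the ONE extra output that the finite-p-rank
re-cut `GeoDictFin` of `L/w41/R2TwoSigma-r19.snippet.lean` (v8 4a4f88c9c8662114 / v9 d77e7518e1f8f795, §σ2.11) asks of the G
construction beyond `GeoDict` (res-L0-w41-plan-1 HANDED v8 05:50:42Z (ii), addressed to «pv-011/096»): for the first chain ring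
`S 0 = T = (R i₀)_{P i₀} ⊆ K` of a dominant tail, the residue field `κ(T)` is a FINITELY GENERATED field extension of the perfect ground
field `k`, so that P `FGFieldPBasisDual` (ORDER P, res-L0-w41-stub-3, LANDED p504438) yields the finite derivation family on `κ(S 0)` with
common kernel the `p`-th powers — the extra hypothesis of `NoEternalIsolatedRadicandChainFin p c` at `S 0`.

Everything is over the SAME def-free interface as G0–G10 (`FrobeniusClosingSteerGeoDictQuadratic.lean` p501788,
`FrobeniusClosingSteerGeoDictShorts.lean` p502487, `FrobeniusClosingSteerGeoDict.lean` p503815, all res-D-pv-011 AS res-L0-w41-stub-7):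

  `hT : ∀ z : K, z ∈ T ↔ ∃ a b : R, b ∉ P ∧ z = a / b`        («`T` is `R_P` inside `K`»),

with `R = locAtCentre A.toSubring O` for a finitely generated `k`-subalgebra `A` of `K` — exactly G3's binders, which the G10 proof
obtains at every tail stage from `SteeredExit.exists_model_of_tower`. Contents:

* `GeoDict.locChar_model_of_locChar` — `R_P = A_{P ∩ A}` inside `K`: the same membership characterisation of `T` over the model `A`
  (this is the computation res-D-pv-011 carries out inline in `GeoDict.isExcellentRing_of_locChar`, exported for re-use);
* `GeoDict.algebraMap_mem_of_locChar` — `T` contains the image of `k`;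
* `GeoDict.essFiniteType_of_locChar` — for ANY `k`-algebra structure on `T` compatible with the coercion to `K`, `T` is essentially of
  finite type over `k` (Mathlib `Algebra.EssFiniteType.of_isLocalization` + `.comp`);
* `GeoDict.fg_top_residueField_of_locChar` — hence `κ(T)` is a finitely generated field extension of `k`
  (`(⊤ : IntermediateField k (ResidueField T)).FG`, Mathlib `IntermediateField.fg_top_iff`), and the instance-free packaging
  `GeoDict.exists_algebra_fg_top_residueField_of_locChar : ∃ _ : Algebra k (ResidueField T), (⊤ : IntermediateField k _).FG`;
* `GeoDict.exists_derivation_commonKernel_residueField_of_locChar` — UNCONDITIONAL (G11a + res-L0-w41-stub-3's P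
  `PBasisDual.exists_derivation_commonKernel_residueField`, `FrobeniusClosingSteerPBasisDual.lean` p504438):
  `∃ (e : ℕ) (D : Fin e → Derivation ℤ κ(T) κ(T)), ∀ z, (∀ l, D l z = 0) ↔ ∃ y, y ^ p = z` for `k` perfect of characteristic `p` —
  literally the extra hypothesis of `NoEternalIsolatedRadicandChainFin p c` at `S 0 = T`.

No named fact; axioms standard. [cite: StacksProject, Tag 07QU] [cite: Matsumura1987, §26 Thm. 26.5] [folklore]
-/

noncomputable section

-- `Summit.<S>.<S>.…` duplicates the summit name by design (single-problem summit).
set_option linter.dupNamespace false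

open IsLocalRing

namespace Summit.ResolutionOfSingularities.ResolutionOfSingularities.Theorems.SwitchingDichotomy

open Literature.AlgebraicGeometry.Resolution

namespace GeoDict

universe u

variable {K : Type u} [Field K] {k : Type u} [Field k] [Algebra k K]

section Model

variable (O : ValuationSubring K) (A : Subalgebra k K) {R : Subring K} (hR : locAtCentre A.toSubring O = R)
  {P : Ideal R} [hP : P.IsPrime] {T : Subring K} (hT : ∀ z : K, z ∈ T ↔ ∃ a b : R, b ∉ P ∧ z = (a : K) / b)
include hR hT

omit hP hT in
/-- `A ⊆ R = A_{𝔪_O ∩ A}`. [folklore] -/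
theorem model_le_of_locAtCentre_eq : A.toSubring ≤ R := hR ▸ le_locAtCentre A.toSubring O

/-- **`R_P = A_{P ∩ A}` inside `K`**: for `R = A_{𝔪_O ∩ A}` (the local ring of the model `A` at the centre of `O`) and a prime `P`
of `R`, the ring `T = R_P ⊆ K` is the set of fractions `a / b` with `a ∈ A`, `b ∈ A ∖ (P ∩ A)`. (The inline computation of
res-D-pv-011's `GeoDict.isExcellentRing_of_locChar`, exported.) [folklore] -/
theorem locChar_model_of_locChar :
    ∀ z : K, z ∈ T ↔ ∃ a b : A.toSubring,
      b ∉ P.comap (Subring.inclusion (model_le_of_locAtCentre_eq O A hR)) ∧ z = (a : K) / b := by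
  have hAR : A.toSubring ≤ R := model_le_of_locAtCentre_eq O A hR
  have hRfrac : ∀ r ∈ R, ∃ a ∈ A, ∃ c ∈ A, O.valuation c = 1 ∧ r = a / c := fun r hr => by
    rw [← hR] at hr
    exact mem_locAtCentre_iff.mp hr
  -- value-`0` elements of `A` are units of `R`, hence outside `P`
  have hunit : ∀ c : K, c ∈ A → O.valuation c = 1 → ∃ hc : c ∈ R, (⟨c, hc⟩ : R) ∉ P := by
    intro c hc hvc
    have hcR : c ∈ R := hAR hc
    have hcinv : c⁻¹ ∈ R := by
      rw [← hR]
      exact inv_mem_locAtCentre (le_locAtCentre A.toSubring O hc) hvc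
    refine ⟨hcR, fun hmem => hP.ne_top (Ideal.eq_top_of_isUnit_mem _ hmem ?_)⟩
    exact (isUnit_subring_iff_inv_mem _).mpr ⟨ne_zero_of_valuation_eq_one hvc, hcinv⟩
  intro z
  constructor
  · intro hz
    obtain ⟨a, b, hb, rfl⟩ := (hT z).mp hz
    obtain ⟨a₁, ha₁, c₁, hc₁, hvc₁, hac⟩ := hRfrac a a.2
    obtain ⟨b₁, hb₁, d₁, hd₁, hvd₁, hbd⟩ := hRfrac b b.2
    obtain ⟨hc₁R, hc₁P⟩ := hunit c₁ hc₁ hvc₁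
    obtain ⟨hd₁R, hd₁P⟩ := hunit d₁ hd₁ hvd₁
    have hd₁0 := ne_zero_of_valuation_eq_one hvd₁
    have hb₁R : b₁ ∈ R := hAR hb₁
    have hb₁P : (⟨b₁, hb₁R⟩ : R) ∉ P := by
      intro hmem
      have : b * ⟨d₁, hd₁R⟩ = ⟨b₁, hb₁R⟩ := by
        apply Subtype.ext
        show (b : K) * d₁ = b₁
        rw [hbd, div_mul_cancel₀ _ hd₁0]
      rcases hP.mem_or_mem (this ▸ hmem : b * ⟨d₁, hd₁R⟩ ∈ P) with h | h
      · exact hb h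
      · exact hd₁P h
    refine ⟨⟨a₁ * d₁, A.mul_mem ha₁ hd₁⟩, ⟨c₁ * b₁, A.mul_mem hc₁ hb₁⟩, ?_, ?_⟩
    · intro hmem
      rw [Ideal.mem_comap] at hmem
      have : (⟨c₁, hc₁R⟩ : R) * ⟨b₁, hb₁R⟩ ∈ P := hmem
      rcases hP.mem_or_mem this with h | h
      · exact hc₁P h
      · exact hb₁P h
    · show (a : K) / b = (a₁ * d₁) / (c₁ * b₁)
      rw [hac, hbd]
      have hc₁0 := ne_zero_of_valuation_eq_one hvc₁
      field_simp
  · rintro ⟨a, b, hb, rfl⟩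
    refine (hT _).mpr ⟨⟨a, hAR a.2⟩, ⟨b, hAR b.2⟩, fun hmem => hb ?_, rfl⟩
    rw [Ideal.mem_comap]
    exact hmem

/-- `T ⊇ R ⊇ A ∋ algebraMap k K c`: the chain ring contains the image of the ground field. [folklore] -/
theorem algebraMap_mem_of_locChar (c : k) : algebraMap k K c ∈ T :=
  le_of_locChar hT (model_le_of_locAtCentre_eq O A hR (A.algebraMap_mem c))

/-- **G11a — `R_P` is essentially of finite type over `k`** when `R = A_{𝔪_O ∩ A}` for a finitely generated `k`-subalgebra `A` of
`K`: `R_P = A_{P ∩ A}` is a localisation of an algebra of finite type. Stated for ANY `k`-algebra structure on `T` compatible with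
the coercion to `K`. [cite: StacksProject, Tag 07QU] [folklore] -/
theorem essFiniteType_of_locChar (hfg : A.FG) [Algebra k T]
    (halg : ∀ c : k, ((algebraMap k T c : T) : K) = algebraMap k K c) : Algebra.EssFiniteType k T := by
  have hAR : A.toSubring ≤ R := model_le_of_locAtCentre_eq O A hR
  have hT' := locChar_model_of_locChar O A hR hT
  set Q : Ideal A.toSubring := P.comap (Subring.inclusion hAR) with hQ
  haveI : Q.IsPrime := Ideal.comap_isPrime _ _
  have hAT : A.toSubring ≤ T := le_of_locChar hT'
  -- the `k`-algebra structure of the model `A.toSubring ⊆ K` induced from `K`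
  letI algkA : Algebra k A.toSubring :=
    ((algebraMap k K).codRestrict A.toSubring fun c => A.algebraMap_mem c).toAlgebra
  -- `A.toSubring` is of finite type over `k`: `A = k[s]` for a finite `s ⊆ K`, and `k[s] → A.toSubring` is onto
  obtain ⟨s, hs⟩ := hfg
  haveI : Algebra.FiniteType k (Algebra.adjoin k (s : Set K)) :=
    Algebra.FiniteType.adjoin_of_finite s.finite_toSet
  let e : Algebra.adjoin k (s : Set K) →ₐ[k] A.toSubring :=
    { toFun := fun a => ⟨(a : K), (hs.le a.2 : (a : K) ∈ A)⟩
      map_one' := rfl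
      map_mul' := fun _ _ => rfl
      map_zero' := rfl
      map_add' := fun _ _ => rfl
      commutes' := fun _ => rfl }
  haveI : Algebra.FiniteType k A.toSubring :=
    Algebra.FiniteType.of_surjective e fun y => ⟨⟨(y : K), hs.symm.le (y.2 : (y : K) ∈ A)⟩, rfl⟩
  -- `T` is the localisation of `A.toSubring` at `Q`
  letI algAT : Algebra A.toSubring T := (Subring.inclusion hAT).toAlgebra
  haveI : IsLocalization.AtPrime T Q := isLocalization_of_locChar hT' fun r => rfl
  haveI : Algebra.EssFiniteType A.toSubring T := Algebra.EssFiniteType.of_isLocalization T Q.primeCompl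
  haveI : IsScalarTower k A.toSubring T := IsScalarTower.of_algebraMap_eq fun c => Subtype.ext (by
    show ((algebraMap k T c : T) : K) = algebraMap k K c
    exact halg c)
  exact Algebra.EssFiniteType.comp k A.toSubring T

/-- **G11b — the residue field of `R_P` is a finitely generated extension of `k`** (for `R = A_{𝔪_O ∩ A}`, `A` a finitely
generated `k`-subalgebra of `K`; any compatible `k`-algebra structure on `T = R_P`). [cite: StacksProject, Tag 07QU] [folklore] -/
theorem fg_top_residueField_of_locChar (hfg : A.FG) [Algebra k T]
    (halg : ∀ c : k, ((algebraMap k T c : T) : K) = algebraMap k K c) [IsLocalRing T] :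
    (⊤ : IntermediateField k (ResidueField T)).FG := by
  haveI := essFiniteType_of_locChar O A hR hT hfg halg
  haveI : Algebra.EssFiniteType k (ResidueField T) :=
    Algebra.EssFiniteType.of_surjective (IsScalarTower.toAlgHom k T (ResidueField T)) residue_surjective
  exact IntermediateField.fg_top_iff.mpr inferInstance

/-- **G11c — instance-free packaging**: `κ(R_P)` carries a `k`-algebra structure (the one induced from `k → K ⊇ R_P → κ(R_P)`) for
which it is a finitely generated field extension of `k`. [folklore] -/
theorem exists_algebra_fg_top_residueField_of_locChar (hfg : A.FG) [IsLocalRing T] :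
    ∃ _ : Algebra k (ResidueField T), (⊤ : IntermediateField k (ResidueField T)).FG := by
  letI : Algebra k T := ((algebraMap k K).codRestrict T (algebraMap_mem_of_locChar O A hR hT)).toAlgebra
  exact ⟨inferInstance, fg_top_residueField_of_locChar O A hR hT hfg (fun _ => rfl)⟩

end Model

/-! ## The residue datum of `NoEternalIsolatedRadicandChainFin` at the first chain ring (P is in the tree: p504438) -/

section ResidueDatum

variable (p : ℕ) [Fact p.Prime] [CharP k p] [PerfectField k]
  (O : ValuationSubring K) (A : Subalgebra k K) {R : Subring K} (hR : locAtCentre A.toSubring O = R)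
  {P : Ideal R} [hP : P.IsPrime] {T : Subring K} (hT : ∀ z : K, z ∈ T ↔ ∃ a b : R, b ∉ P ∧ z = (a : K) / b)
include hR hT

/-- **G11 — the residue datum of `S 0`, UNCONDITIONAL.** For a perfect ground field `k` of characteristic `p`, a finitely generated
`k`-subalgebra `A` of `K`, `R = A_{𝔪_O ∩ A}`, a prime `P` of `R` and the chain ring `T = R_P ⊆ K`, the residue field `κ(T)` carries a
finite family of derivations whose common kernel is exactly the `p`-th powers — literally the extra hypothesis of
`NoEternalIsolatedRadicandChainFin p c` at `S 0 = T` (G11a + res-L0-w41-stub-3's P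
`PBasisDual.exists_derivation_commonKernel_residueField`, p504438). [cite: Matsumura1987, §26 Thm. 26.5] [folklore] -/
theorem exists_derivation_commonKernel_residueField_of_locChar (hfg : A.FG) [IsLocalRing T] :
    ∃ (e : ℕ) (D : Fin e → Derivation ℤ (ResidueField T) (ResidueField T)),
      ∀ z : ResidueField T, (∀ l, D l z = 0) ↔ ∃ y : ResidueField T, y ^ p = z := by
  letI : Algebra k T := ((algebraMap k K).codRestrict T (algebraMap_mem_of_locChar O A hR hT)).toAlgebra
  haveI := essFiniteType_of_locChar O A hR hT hfg (fun _ => rfl)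
  exact PBasisDual.exists_derivation_commonKernel_residueField k p

end ResidueDatum

end GeoDict

end Summit.ResolutionOfSingularities.ResolutionOfSingularities.Theorems.SwitchingDichotomy

end
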